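import Mathlib
import HarnessLib
import Summits.AtomisticToContinuum.BoseEinsteinCondensation.Theses.BECWallDressingTransfer

/-!
# Birth skeleton (BC3) for crux `WallDressing` (stmt-AtomisticToContinuum-13825)

Route `BECWallDressingTransfer` (sub-problem `BoseEinsteinCondensation`), crux rank 2: for
`w_D`-typical environments `Y ∈ (ℝ³)^N` the one-particle ratio `Ψ₀(x::Y)/(Φ₀(x::Y)·s(x))`
(Dirichlet ground state over torus ground state times a one-body wall profile `s` of some scale
`ℓ ∈ (0, εL]`) oscillates over the inner cube `Λ_a = (a, L−a)³` by at most a factor `C` uniform in `N`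
(typed a.e.: the violating pairs `(x,y) ∈ Λ_a²` have volume `0` off a set of environments of
`w_D`-mass `≤ η`).

## Reading of the crux used by this line

`C` is chosen after `ρ` and `a`, and `ℓ` is only required to satisfy `0 < ℓ ≤ εL`; with the
admissible choice `ℓ := min a (εL)` the wall profile is `≡ 1` on `Λ_a` (`wallProfile_eq_one`, the
Lean fact recorded by refuter rattack-13825, W2.lean). So the crux is exactly a TWO-SIDED,
`s`-free comparison of the Dirichlet slice `x ↦ Ψ₀(x::Y)` with the torus slice `x ↦ Φ₀(x::Y)` on
`Λ_a`, for `w_D`-typical `Y`, uniform in `N` (constants may depend on `v, a, ρ`).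

## The cut (three named stubs, composition `WallDressing_of` sorry-free)

Fix the a.e.-robust REFERENCE LEVEL of an environment `Y` (the classical "value at an interior
reference point" of a boundary Harnack principle, averaged over the central cube
`Λ_c = (L/4, 3L/4)³`): `r(Y) = (∫_{Λ_c} Ψ₀(z::Y) dz) / (∫_{Λ_c} Φ₀(z::Y) dz)` (real division, junk `0`).

* `stub_interiorHarnack` (screening in the bulk; two-sided interior Harnack inequality for the
  `h`-transform `h = Ψ_D/Φ_P`): for every `ε > 0`, for `w_D`-all-but-`η` environments,
  `K⁻¹ r(Y) Φ₀(x::Y) ≤ Ψ₀(x::Y) ≤ K r(Y) Φ₀(x::Y)` for a.e. `x ∈ Λ_ε = (εL, L−εL)³`, `K = K(v,a,ρ,ε,η)`.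
* `stub_boundaryCarleson` (upper boundary-Harnack half, Carleson-type estimate): on SOME macroscopic
  boundary layer `Λ_a ∖ Λ_{ε₀}` (`ε₀ = ε₀(v,a,ρ) > 0`), `Ψ₀(x::Y) ≤ K r(Y) Φ₀(x::Y)` a.e., typical `Y`.
* `stub_boundaryHealing` (lower boundary-Harnack half, Hopf/healing-type estimate): on some layer
  `Λ_a ∖ Λ_{ε₀}`, `r(Y) Φ₀(x::Y) ≤ K Ψ₀(x::Y)` a.e., typical `Y` — the Dirichlet state has healed back to
  `K⁻¹ ×` the bulk ratio already at distance `a` from the faces (`K ~ ξ/a` expected, `ξ = (8πρ𝔞)^{-1/2}`).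

Typicality is typed as an OUTER exceptional set: `∃ B ⊆ (ℝ³)^N, ∫⁻_{Y ∈ B} (∫Ψ₀(x::Y)²dx) ≤ η` and
the property for every `Y ∉ B` (set-lintegrals are subadditive in the set with no measurability, which
is what lets three exceptional sets merge; the crux's inner-indicator form is weaker, so the stubs imply it).

`WallDressing_of : stub₁-sig → stub₂-sig → stub₃-sig → WallDressing` (hypotheses keyed by the
registered stub names `__Registered.stub_…`, conclusion the route decl BY NAME) is a real proof:
`a₀ = max`, `ρ₀ = min`, interior stub at `ε* = min ε₂ ε₃`, budgets `η/3`, `C = max K₁ K₂ · max K₁ K₃`,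
`ℓ = min a (εL)` (so `s ≡ 1` on `Λ_a`), upper bound on `Λ_a` = interior-upper on `Λ_{ε*}` + Carleson on
the layer, lower bound likewise; for a good `Y` the violating pairs lie in
`(S_U × ℝ³) ∪ (ℝ³ × S_L)` with `S_U, S_L` Lebesgue-null (`Measure.prod_prod`), so their volume is `0`;
the bad environments lie in `B₁ ∪ B₂ ∪ B₃`, and `lintegral_indicator_le` + `lintegral_union_le` give
`≤ η/3 + η/3 + η/3`. Faithfulness (paper): conversely WallDressing(C) with `ℓ ≤ L/4` and `Λ_c ⊆ Λ_a`
gives all three stubs with `K = C` off the same bad set plus the `w_D`-null nondegeneracy set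
`{∫_{Λ_c} Φ₀(·::Y) = 0 < ∫ Ψ₀(·::Y)²}` (integrate the a.e. pair inequality over the reference
variable in `Λ_c`), so the cut loses only constants.

Disproof used: no `Disproof.lean` exists on this crux (`ledger crux ls stmt-AtomisticToContinuum-13825`:
no workfiles, 2026-08-17). Refuter rattack-13825's paper witness (wall cages, refuted-misstated note,
repair `C′ = WallDressingWeighted`) — if it stands — lands on the LAYER stubs (2)/(3), not on (1); the
same cut transfers verbatim to `C′` (weighted exceptional `x`-sets instead of Lebesgue-null ones).
-/

noncomputable section

namespace Summit.AtomisticToContinuum.BoseEinsteinCondensation.Cruxes.WallDressing.Birth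

open scoped BigOperators ENNReal NNReal
open MeasureTheory Filter
open Literature.MathematicalPhysics.QuantumManyBody.BoseGas
open Summit.AtomisticToContinuum.BoseEinsteinCondensation.Theses.BECWallDressingTransfer (WallDressing)

/-! ## The three intermediate statements of the line (named; bodies over tree vocabulary) -/

/-- **Interior Harnack for the wall ratio (screening in the bulk).** For every repulsive finite-range
`v` there is `a₀ > 0` such that for every `a ≥ a₀`, at all small `ρ`, for every `ε > 0`, `η > 0` there is
`K > 0` with: for all large `N`, if the Dirichlet ground state `Ψ₀` of `N+1` bosons in the box of side
`L = sideLength ρ (N+1)` is unique, then for every torus ground state `Φ₀` of side `L+a` (inlined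
interface of the route) there is an exceptional set `B` of environments of `w_D`-mass `≤ η` off which,
for a.e. `x` in the inner cube `Λ_ε = (εL, L−εL)³`,
`r(Y) Φ₀(x::Y) ≤ K Ψ₀(x::Y)` and `Ψ₀(x::Y) ≤ K r(Y) Φ₀(x::Y)`, with the reference level
`r(Y) = ∫_{Λ_c} Ψ₀(z::Y)dz / ∫_{Λ_c} Φ₀(z::Y)dz`, `Λ_c = (L/4, 3L/4)³`. [folklore] -/
def InteriorHarnack : Prop :=
  ∀ v : ℝ → ENNReal, IsRepulsiveFiniteRange v → ∃ a₀ : ℝ, 0 < a₀ ∧ ∀ a : ℝ, a₀ ≤ a →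
    ∃ ρ₀ : ℝ, 0 < ρ₀ ∧ ∀ ρ : ℝ, 0 < ρ → ρ < ρ₀ → ∀ ε : ℝ, 0 < ε → ∀ η : ℝ, 0 < η →
      ∃ K : ℝ, 0 < K ∧ ∀ᶠ N : ℕ in Filter.atTop,
        let L : ℝ := sideLength ρ (N + 1);
        let Ψ₀ : Config (N + 1) → ℝ := groundState v (N + 1) L;
        HasUniqueGroundState v (N + 1) L →
          let Λε : Set Space := {z : Space | ∀ k, z k ∈ Set.Ioo (ε * L) (L - ε * L)};
          let Λc : Set Space := {z : Space | ∀ k, z k ∈ Set.Ioo (L / 4) (3 * L / 4)};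
          ∀ Φ₀ : Config (N + 1) → ℝ,
            (Continuous Φ₀ ∧
              (∀ (X : Config (N + 1)) (i : Fin (N + 1)) (k : Fin 3),
                Φ₀ (X + Pi.single i (EuclideanSpace.single k (L + a))) = Φ₀ X) ∧
              (∀ X, 0 ≤ Φ₀ X) ∧
              ∀ η' : ℝ, 0 < η' → ∃ δ : ENNReal, 0 < δ ∧
                ∀ Φ : PeriodicTrialState (N + 1) (L + a),
                  periodicEnergy v Φ ≤ periodicGroundStateEnergy v (N + 1) (L + a) + δ →
                    ∃ θ : ℝ, ∫⁻ X in cellN (N + 1) (L + a),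
                      (‖Φ.ψ X - Complex.exp (↑θ * Complex.I) * (Φ₀ X : ℂ)‖₊ : ENNReal) ^ 2 ≤
                        ENNReal.ofReal η') →
            ∃ B : Set (Config N),
              (∫⁻ Y in B, ∫⁻ x : Space, ENNReal.ofReal (Ψ₀ (Matrix.vecCons x Y) ^ 2)) ≤
                  ENNReal.ofReal η ∧
              ∀ Y : Config N, Y ∉ B → ∀ᵐ x : Space, x ∈ Λε →
                (∫ z in Λc, Ψ₀ (Matrix.vecCons z Y)) / (∫ z in Λc, Φ₀ (Matrix.vecCons z Y)) *
                      Φ₀ (Matrix.vecCons x Y) ≤ K * Ψ₀ (Matrix.vecCons x Y) ∧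
                  Ψ₀ (Matrix.vecCons x Y) ≤
                    K * ((∫ z in Λc, Ψ₀ (Matrix.vecCons z Y)) / (∫ z in Λc, Φ₀ (Matrix.vecCons z Y))) *
                      Φ₀ (Matrix.vecCons x Y)

/-- **Boundary Carleson bound (upper half of the boundary Harnack comparison).** Same data; for
every repulsive finite-range `v` there is `a₀ > 0` such that for every `a ≥ a₀`, at all small `ρ`, there is
a layer fraction `ε₀ > 0` such that for every `η > 0` some `K > 0` works for all large `N`: off an
exceptional set of environments of `w_D`-mass `≤ η`, for a.e. `x` in the boundary layer
`Λ_a ∖ Λ_{ε₀}` (`Λ_a = (a, L−a)³`), `Ψ₀(x::Y) ≤ K r(Y) Φ₀(x::Y)` — the Dirichlet slice never exceeds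
`K ×` (bulk reference ratio) `×` torus slice near the faces. [folklore] -/
def BoundaryCarleson : Prop :=
  ∀ v : ℝ → ENNReal, IsRepulsiveFiniteRange v → ∃ a₀ : ℝ, 0 < a₀ ∧ ∀ a : ℝ, a₀ ≤ a →
    ∃ ρ₀ : ℝ, 0 < ρ₀ ∧ ∀ ρ : ℝ, 0 < ρ → ρ < ρ₀ → ∃ ε₀ : ℝ, 0 < ε₀ ∧ ∀ η : ℝ, 0 < η →
      ∃ K : ℝ, 0 < K ∧ ∀ᶠ N : ℕ in Filter.atTop,
        let L : ℝ := sideLength ρ (N + 1);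
        let Ψ₀ : Config (N + 1) → ℝ := groundState v (N + 1) L;
        HasUniqueGroundState v (N + 1) L →
          let Λa : Set Space := {z : Space | ∀ k, z k ∈ Set.Ioo a (L - a)};
          let Λε : Set Space := {z : Space | ∀ k, z k ∈ Set.Ioo (ε₀ * L) (L - ε₀ * L)};
          let Λc : Set Space := {z : Space | ∀ k, z k ∈ Set.Ioo (L / 4) (3 * L / 4)};
          ∀ Φ₀ : Config (N + 1) → ℝ,
            (Continuous Φ₀ ∧
              (∀ (X : Config (N + 1)) (i : Fin (N + 1)) (k : Fin 3),
                Φ₀ (X + Pi.single i (EuclideanSpace.single k (L + a))) = Φ₀ X) ∧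
              (∀ X, 0 ≤ Φ₀ X) ∧
              ∀ η' : ℝ, 0 < η' → ∃ δ : ENNReal, 0 < δ ∧
                ∀ Φ : PeriodicTrialState (N + 1) (L + a),
                  periodicEnergy v Φ ≤ periodicGroundStateEnergy v (N + 1) (L + a) + δ →
                    ∃ θ : ℝ, ∫⁻ X in cellN (N + 1) (L + a),
                      (‖Φ.ψ X - Complex.exp (↑θ * Complex.I) * (Φ₀ X : ℂ)‖₊ : ENNReal) ^ 2 ≤
                        ENNReal.ofReal η') →
            ∃ B : Set (Config N),
              (∫⁻ Y in B, ∫⁻ x : Space, ENNReal.ofReal (Ψ₀ (Matrix.vecCons x Y) ^ 2)) ≤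
                  ENNReal.ofReal η ∧
              ∀ Y : Config N, Y ∉ B → ∀ᵐ x : Space, x ∈ Λa → x ∉ Λε →
                Ψ₀ (Matrix.vecCons x Y) ≤
                  K * ((∫ z in Λc, Ψ₀ (Matrix.vecCons z Y)) / (∫ z in Λc, Φ₀ (Matrix.vecCons z Y))) *
                    Φ₀ (Matrix.vecCons x Y)

/-- **Boundary healing bound (lower half of the boundary Harnack comparison; Hopf-type).** Same data
and quantifiers as `BoundaryCarleson`; conclusion: for a.e. `x` in the boundary layer `Λ_a ∖ Λ_{ε₀}`,
`r(Y) Φ₀(x::Y) ≤ K Ψ₀(x::Y)` — at distance `≥ a` from the faces the Dirichlet slice has healed back to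
at least `K⁻¹ ×` (bulk reference ratio) `×` torus slice, uniformly in `N` (`K ~ ξ/a` expected). [folklore] -/
def BoundaryHealing : Prop :=
  ∀ v : ℝ → ENNReal, IsRepulsiveFiniteRange v → ∃ a₀ : ℝ, 0 < a₀ ∧ ∀ a : ℝ, a₀ ≤ a →
    ∃ ρ₀ : ℝ, 0 < ρ₀ ∧ ∀ ρ : ℝ, 0 < ρ → ρ < ρ₀ → ∃ ε₀ : ℝ, 0 < ε₀ ∧ ∀ η : ℝ, 0 < η →
      ∃ K : ℝ, 0 < K ∧ ∀ᶠ N : ℕ in Filter.atTop,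
        let L : ℝ := sideLength ρ (N + 1);
        let Ψ₀ : Config (N + 1) → ℝ := groundState v (N + 1) L;
        HasUniqueGroundState v (N + 1) L →
          let Λa : Set Space := {z : Space | ∀ k, z k ∈ Set.Ioo a (L - a)};
          let Λε : Set Space := {z : Space | ∀ k, z k ∈ Set.Ioo (ε₀ * L) (L - ε₀ * L)};
          let Λc : Set Space := {z : Space | ∀ k, z k ∈ Set.Ioo (L / 4) (3 * L / 4)};
          ∀ Φ₀ : Config (N + 1) → ℝ,
            (Continuous Φ₀ ∧
              (∀ (X : Config (N + 1)) (i : Fin (N + 1)) (k : Fin 3),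
                Φ₀ (X + Pi.single i (EuclideanSpace.single k (L + a))) = Φ₀ X) ∧
              (∀ X, 0 ≤ Φ₀ X) ∧
              ∀ η' : ℝ, 0 < η' → ∃ δ : ENNReal, 0 < δ ∧
                ∀ Φ : PeriodicTrialState (N + 1) (L + a),
                  periodicEnergy v Φ ≤ periodicGroundStateEnergy v (N + 1) (L + a) + δ →
                    ∃ θ : ℝ, ∫⁻ X in cellN (N + 1) (L + a),
                      (‖Φ.ψ X - Complex.exp (↑θ * Complex.I) * (Φ₀ X : ℂ)‖₊ : ENNReal) ^ 2 ≤
                        ENNReal.ofReal η') →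
            ∃ B : Set (Config N),
              (∫⁻ Y in B, ∫⁻ x : Space, ENNReal.ofReal (Ψ₀ (Matrix.vecCons x Y) ^ 2)) ≤
                  ENNReal.ofReal η ∧
              ∀ Y : Config N, Y ∉ B → ∀ᵐ x : Space, x ∈ Λa → x ∉ Λε →
                (∫ z in Λc, Ψ₀ (Matrix.vecCons z Y)) / (∫ z in Λc, Φ₀ (Matrix.vecCons z Y)) *
                    Φ₀ (Matrix.vecCons x Y) ≤ K * Ψ₀ (Matrix.vecCons x Y)

/-! ## Stubs (the open lemmas of the line; `sorry` only here)

Each stub is stated over TREE VOCABULARY ONLY (bodies written out; `open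
Literature.MathematicalPhysics.QuantumManyBody.BoseGas` for the short names), so that it lands verbatim as
`Theorems/BECWallDressingTransferWallDressing<Stub>.lean --supports stmt-AtomisticToContinuum-13825` without
importing this workfile; the `*_holds` theorems below certify definitionally that the written-out text IS the
named statement. -/

/-- **Stub 1 — `stub_interiorHarnack` (screening in the bulk; size XL).** `InteriorHarnack`, written out.
Why plausibly true: at distance `≥ εL ≫ ξ = (8πρ𝔞)^{-1/2}` from every face both `Ψ_D(·::Y)` and
`Φ_P(·::Y)` are governed by the same bulk physics and the wall's influence on the tagged variable is
screened beyond the healing length, so `h = Ψ_D/Φ_P` should be constant in `x` over `Λ_ε` up to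
`1 + O(e^{-εL/ξ})` for typical `Y` (free gas: `h ∝ ∏ sin(πx_k/L)`, two-sided bound with
`K = (sin(πε))^{-3}`, bad set empty). It is the interior Harnack inequality (Moser: local boundedness +
weak Harnack) for the `h`-transform of the torus ground-state diffusion
`L = Δ + 2∇log Φ_P·∇`, for which `h` is a positive supersolution `(−L)h = (E_D − E_P) h`; the whole
difficulty is uniformity of the constant in the dimension `3N` (the killing rate `E_D − E_P ≍ N^{2/3}` is a
SUM of one-body wall energies, so only product structure can beat the generic `e^{√(E_D−E_P)·L}`).
Why it might fail: Harnack/IU constants of `L` grow with dimension (Davies–Simon) unless the drift is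
controlled uniformly (Wang); a delocalised phonon response of the bath to the wall could make `h(·::Y)`
drift by `log L` across the bulk. Not cheaply the crux: says nothing within `εL` of the faces.
Leans on: `groundState`, `HasUniqueGroundState` (GroundState.lean), `GroundStateFeynmanKac*`
(Perron–Frobenius at fixed `N`), inlined torus interface.
[cite: DaviesSimon1984; Wang2012; LSSY2005, Ch. 6–7] -/
theorem stub_interiorHarnack :
    ∀ v : ℝ → ENNReal, IsRepulsiveFiniteRange v → ∃ a₀ : ℝ, 0 < a₀ ∧ ∀ a : ℝ, a₀ ≤ a →
    ∃ ρ₀ : ℝ, 0 < ρ₀ ∧ ∀ ρ : ℝ, 0 < ρ → ρ < ρ₀ → ∀ ε : ℝ, 0 < ε → ∀ η : ℝ, 0 < η →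
      ∃ K : ℝ, 0 < K ∧ ∀ᶠ N : ℕ in Filter.atTop,
        let L : ℝ := sideLength ρ (N + 1);
        let Ψ₀ : Config (N + 1) → ℝ := groundState v (N + 1) L;
        HasUniqueGroundState v (N + 1) L →
          let Λε : Set Space := {z : Space | ∀ k, z k ∈ Set.Ioo (ε * L) (L - ε * L)};
          let Λc : Set Space := {z : Space | ∀ k, z k ∈ Set.Ioo (L / 4) (3 * L / 4)};
          ∀ Φ₀ : Config (N + 1) → ℝ,
            (Continuous Φ₀ ∧
              (∀ (X : Config (N + 1)) (i : Fin (N + 1)) (k : Fin 3),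
                Φ₀ (X + Pi.single i (EuclideanSpace.single k (L + a))) = Φ₀ X) ∧
              (∀ X, 0 ≤ Φ₀ X) ∧
              ∀ η' : ℝ, 0 < η' → ∃ δ : ENNReal, 0 < δ ∧
                ∀ Φ : PeriodicTrialState (N + 1) (L + a),
                  periodicEnergy v Φ ≤ periodicGroundStateEnergy v (N + 1) (L + a) + δ →
                    ∃ θ : ℝ, ∫⁻ X in cellN (N + 1) (L + a),
                      (‖Φ.ψ X - Complex.exp (↑θ * Complex.I) * (Φ₀ X : ℂ)‖₊ : ENNReal) ^ 2 ≤
                        ENNReal.ofReal η') →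
            ∃ B : Set (Config N),
              (∫⁻ Y in B, ∫⁻ x : Space, ENNReal.ofReal (Ψ₀ (Matrix.vecCons x Y) ^ 2)) ≤
                  ENNReal.ofReal η ∧
              ∀ Y : Config N, Y ∉ B → ∀ᵐ x : Space, x ∈ Λε →
                (∫ z in Λc, Ψ₀ (Matrix.vecCons z Y)) / (∫ z in Λc, Φ₀ (Matrix.vecCons z Y)) *
                      Φ₀ (Matrix.vecCons x Y) ≤ K * Ψ₀ (Matrix.vecCons x Y) ∧
                  Ψ₀ (Matrix.vecCons x Y) ≤
                    K * ((∫ z in Λc, Ψ₀ (Matrix.vecCons z Y)) / (∫ z in Λc, Φ₀ (Matrix.vecCons z Y))) *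
                      Φ₀ (Matrix.vecCons x Y) := by
  sorry

/-- **Stub 2 — `stub_boundaryCarleson` (upper boundary-Harnack half; size XL).** `BoundaryCarleson`,
written out. Why plausibly true: it is the Carleson-type estimate of the boundary Harnack principle for the
positive `L`-supersolution `h = Ψ_D/Φ_P` vanishing on the faces (Bass–Burdzy, Davies–Simon IU ⇒
`h(x::Y) ≤ C h(x₀::Y)` near the boundary), with the interior reference value replaced by the
a.e.-robust central-cube average `r(Y)`; in the product caricature `h ≈ ∏ᵢ s_ξ(xᵢ)·const` it holds with
`K = 1 + o(1)` since `s_ξ ≤ 1` (free gas: `K = 1/ (sin ... )` empty bad set). The prover chooses the layer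
fraction `ε₀` (any macroscopic layer will do once Stub 1 is available). Why it might fail: same
dimension-dependence of IU/BHP constants; for `⊤`-valued `v` near-wall cages of bath particles can pinch
the accessible region of the tagged particle (refuter rattack-13825's wall-cage witness bears on the layer
stubs). Not cheaply the crux: one-sided, and silent on `Λ_{ε₀}`.
Leans on: as Stub 1, plus `WallLayerMass`-type Hardy control of the layer (route item 13828).
[cite: BassBurdzy1991; DaviesSimon1984; LSSY2005, Ch. 6–7] -/
theorem stub_boundaryCarleson :
    ∀ v : ℝ → ENNReal, IsRepulsiveFiniteRange v → ∃ a₀ : ℝ, 0 < a₀ ∧ ∀ a : ℝ, a₀ ≤ a →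
    ∃ ρ₀ : ℝ, 0 < ρ₀ ∧ ∀ ρ : ℝ, 0 < ρ → ρ < ρ₀ → ∃ ε₀ : ℝ, 0 < ε₀ ∧ ∀ η : ℝ, 0 < η →
      ∃ K : ℝ, 0 < K ∧ ∀ᶠ N : ℕ in Filter.atTop,
        let L : ℝ := sideLength ρ (N + 1);
        let Ψ₀ : Config (N + 1) → ℝ := groundState v (N + 1) L;
        HasUniqueGroundState v (N + 1) L →
          let Λa : Set Space := {z : Space | ∀ k, z k ∈ Set.Ioo a (L - a)};
          let Λε : Set Space := {z : Space | ∀ k, z k ∈ Set.Ioo (ε₀ * L) (L - ε₀ * L)};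
          let Λc : Set Space := {z : Space | ∀ k, z k ∈ Set.Ioo (L / 4) (3 * L / 4)};
          ∀ Φ₀ : Config (N + 1) → ℝ,
            (Continuous Φ₀ ∧
              (∀ (X : Config (N + 1)) (i : Fin (N + 1)) (k : Fin 3),
                Φ₀ (X + Pi.single i (EuclideanSpace.single k (L + a))) = Φ₀ X) ∧
              (∀ X, 0 ≤ Φ₀ X) ∧
              ∀ η' : ℝ, 0 < η' → ∃ δ : ENNReal, 0 < δ ∧
                ∀ Φ : PeriodicTrialState (N + 1) (L + a),
                  periodicEnergy v Φ ≤ periodicGroundStateEnergy v (N + 1) (L + a) + δ →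
                    ∃ θ : ℝ, ∫⁻ X in cellN (N + 1) (L + a),
                      (‖Φ.ψ X - Complex.exp (↑θ * Complex.I) * (Φ₀ X : ℂ)‖₊ : ENNReal) ^ 2 ≤
                        ENNReal.ofReal η') →
            ∃ B : Set (Config N),
              (∫⁻ Y in B, ∫⁻ x : Space, ENNReal.ofReal (Ψ₀ (Matrix.vecCons x Y) ^ 2)) ≤
                  ENNReal.ofReal η ∧
              ∀ Y : Config N, Y ∉ B → ∀ᵐ x : Space, x ∈ Λa → x ∉ Λε →
                Ψ₀ (Matrix.vecCons x Y) ≤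
                  K * ((∫ z in Λc, Ψ₀ (Matrix.vecCons z Y)) / (∫ z in Λc, Φ₀ (Matrix.vecCons z Y))) *
                    Φ₀ (Matrix.vecCons x Y) := by
  sorry

/-- **Stub 3 — `stub_boundaryHealing` (lower boundary-Harnack half, Hopf/healing type; THE HEART;
size XL / open).** `BoundaryHealing`, written out. Why plausibly true: Gross–Pitaevskii boundary-layer
theory — the condensate wave function heals from `0` at a hard wall to its bulk value over the healing
length `ξ = (8πρ𝔞)^{-1/2}` (`tanh(d/√2ξ)` profile, LSSY Ch. 6–7, Margetis), so at distance `≥ a` the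
many-body ratio should already be `≥ c·min(1, a/ξ) ×` bulk ratio; probabilistically it is the lower
(Hopf-lemma) half of the boundary Harnack principle for the killed ground-state diffusion: the tagged
particle started at distance `a` from the face escapes to the bulk before being killed with probability
bounded below uniformly in the (typical) bath — the bet being that the bath enters only through a
drift whose effect on ONE coordinate is dimension-free (Wang-type Harnack with uniformly controlled
drift). Why it might fail: this is where a `log L` loss from an unscreened phonon tail, or the refuter's
near-wall cage pockets for `⊤`/soft-sphere `v`, would show up first (ess-inf over the layer is the fragile
side); constants of every known BHP grow with the dimension `3N`. Not cheaply the crux: one-sided,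
silent on `Λ_{ε₀}`. Leans on: as Stub 1; `BoseGasDirichletWall`, `BoseGasHardLayerHardy` (layer Hardy
technology in tree). [cite: LiebSeiringer2002; LSSY2005, Ch. 6–7; Margetis2000; Wang2012; BassBurdzy1991] -/
theorem stub_boundaryHealing :
    ∀ v : ℝ → ENNReal, IsRepulsiveFiniteRange v → ∃ a₀ : ℝ, 0 < a₀ ∧ ∀ a : ℝ, a₀ ≤ a →
    ∃ ρ₀ : ℝ, 0 < ρ₀ ∧ ∀ ρ : ℝ, 0 < ρ → ρ < ρ₀ → ∃ ε₀ : ℝ, 0 < ε₀ ∧ ∀ η : ℝ, 0 < η →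
      ∃ K : ℝ, 0 < K ∧ ∀ᶠ N : ℕ in Filter.atTop,
        let L : ℝ := sideLength ρ (N + 1);
        let Ψ₀ : Config (N + 1) → ℝ := groundState v (N + 1) L;
        HasUniqueGroundState v (N + 1) L →
          let Λa : Set Space := {z : Space | ∀ k, z k ∈ Set.Ioo a (L - a)};
          let Λε : Set Space := {z : Space | ∀ k, z k ∈ Set.Ioo (ε₀ * L) (L - ε₀ * L)};
          let Λc : Set Space := {z : Space | ∀ k, z k ∈ Set.Ioo (L / 4) (3 * L / 4)};
          ∀ Φ₀ : Config (N + 1) → ℝ,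
            (Continuous Φ₀ ∧
              (∀ (X : Config (N + 1)) (i : Fin (N + 1)) (k : Fin 3),
                Φ₀ (X + Pi.single i (EuclideanSpace.single k (L + a))) = Φ₀ X) ∧
              (∀ X, 0 ≤ Φ₀ X) ∧
              ∀ η' : ℝ, 0 < η' → ∃ δ : ENNReal, 0 < δ ∧
                ∀ Φ : PeriodicTrialState (N + 1) (L + a),
                  periodicEnergy v Φ ≤ periodicGroundStateEnergy v (N + 1) (L + a) + δ →
                    ∃ θ : ℝ, ∫⁻ X in cellN (N + 1) (L + a),
                      (‖Φ.ψ X - Complex.exp (↑θ * Complex.I) * (Φ₀ X : ℂ)‖₊ : ENNReal) ^ 2 ≤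
                        ENNReal.ofReal η') →
            ∃ B : Set (Config N),
              (∫⁻ Y in B, ∫⁻ x : Space, ENNReal.ofReal (Ψ₀ (Matrix.vecCons x Y) ^ 2)) ≤
                  ENNReal.ofReal η ∧
              ∀ Y : Config N, Y ∉ B → ∀ᵐ x : Space, x ∈ Λa → x ∉ Λε →
                (∫ z in Λc, Ψ₀ (Matrix.vecCons z Y)) / (∫ z in Λc, Φ₀ (Matrix.vecCons z Y)) *
                    Φ₀ (Matrix.vecCons x Y) ≤ K * Ψ₀ (Matrix.vecCons x Y) := by
  sorry

/-! ## Consistency: each named statement IS its stub (definitionally) -/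

theorem interiorHarnack_holds : InteriorHarnack := stub_interiorHarnack
theorem boundaryCarleson_holds : BoundaryCarleson := stub_boundaryCarleson
theorem boundaryHealing_holds : BoundaryHealing := stub_boundaryHealing

/-! ## Registered-name aliases

The skeleton audit (`ledger skeleton check`, A12) admits a hypothesis of the skeleton theorem only when its head
constant is a registered obligation or is NAMED like a declared stub; `__Registered.stub_X` is the statement of
`stub_X` under that name (device of the tree's other `Cruxes/*/Lines/birth.lean` files; the `@[stub]` attribute is
gate-reserved). Each alias is `rfl`-equal to its statement. -/
namespace __Registered

/-- Alias of `InteriorHarnack` keyed by the registered stub name. -/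
abbrev stub_interiorHarnack : Prop := InteriorHarnack
/-- Alias of `BoundaryCarleson` keyed by the registered stub name. -/
abbrev stub_boundaryCarleson : Prop := BoundaryCarleson
/-- Alias of `BoundaryHealing` keyed by the registered stub name. -/
abbrev stub_boundaryHealing : Prop := BoundaryHealing

end __Registered

/-! ## Plumbing lemmas for the composition (all sorry-free) -/

/-- On the inner cube `Λ_a` the one-body wall profile of any scale `0 < ℓ ≤ a` is identically `1`
(every coordinate is at distance `> a ≥ ℓ` from both faces). [folklore] -/
theorem wallProfile_eq_one {a L ℓ : ℝ} (hℓ : 0 < ℓ) (hℓa : ℓ ≤ a) {z : Space}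
    (hz : ∀ k, z k ∈ Set.Ioo a (L - a)) :
    (∏ k : Fin 3, min 1 (min (z k / ℓ) ((L - z k) / ℓ))) = 1 := by
  refine Finset.prod_eq_one fun k _ => ?_
  have h1 : ℓ ≤ z k := hℓa.trans (hz k).1.le
  have h2 : ℓ ≤ L - z k := by
    have := (hz k).2
    linarith
  exact min_eq_left (le_min ((one_le_div hℓ).2 h1) ((one_le_div hℓ).2 h2))

/-- The box side `L = ((N+1)/ρ)^{1/3}` is positive. [folklore] -/
theorem sideLength_succ_pos {ρ : ℝ} (hρ : 0 < ρ) (N : ℕ) : 0 < sideLength ρ (N + 1) := by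
  unfold sideLength
  exact Real.rpow_pos_of_pos (div_pos (Nat.cast_pos.2 (Nat.succ_pos N)) hρ) _

/-- Inner cubes are nested: `Λ_ε ⊆ Λ_{ε'}` for `ε' ≤ ε` (and `L ≥ 0`). [folklore] -/
theorem innerCube_mono {L ε ε' : ℝ} (hL : 0 ≤ L) (h : ε' ≤ ε) :
    {z : Space | ∀ k, z k ∈ Set.Ioo (ε * L) (L - ε * L)} ⊆
      {z : Space | ∀ k, z k ∈ Set.Ioo (ε' * L) (L - ε' * L)} := by
  intro z hz k
  have hm : ε' * L ≤ ε * L := mul_le_mul_of_nonneg_right h hL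
  have hk := hz k
  exact ⟨hm.trans_lt hk.1, hk.2.trans_le (by linarith)⟩

/-- `p ≤ K t` with `p ≥ 0`, `K > 0` upgrades to `p ≤ max K K' · t` (if `t < 0` the hypothesis is
absurd). [folklore] -/
theorem le_max_mul_left {p t K K' : ℝ} (hp : 0 ≤ p) (hK : 0 < K) (h : p ≤ K * t) :
    p ≤ max K K' * t := by
  rcases le_or_gt 0 t with ht | ht
  · exact h.trans (mul_le_mul_of_nonneg_right (le_max_left _ _) ht)
  · exact absurd h (not_le.2 ((mul_neg_of_pos_of_neg hK ht).trans_le hp))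

/-- Symmetric form of `le_max_mul_left`. [folklore] -/
theorem le_max_mul_right {p t K K' : ℝ} (hp : 0 ≤ p) (hK : 0 < K) (h : p ≤ K * t) :
    p ≤ max K' K * t := by
  rw [max_comm]
  exact le_max_mul_left hp hK h

/-- Upper comparison on the whole inner cube `S` from the interior two-sided bound on `T` and the
boundary upper bound on `S ∖ T'`, `T' ⊆ T`. [folklore] -/
theorem ae_upper_of_interior_of_layer {S T T' : Set Space} {ψ φ : Space → ℝ} {KI KU r : ℝ}
    (hsub : T' ⊆ T) (hψ : ∀ x, 0 ≤ ψ x) (hKI : 0 < KI) (hKU : 0 < KU)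
    (hI : ∀ᵐ x : Space, x ∈ T → r * φ x ≤ KI * ψ x ∧ ψ x ≤ KI * r * φ x)
    (hU : ∀ᵐ x : Space, x ∈ S → x ∉ T' → ψ x ≤ KU * r * φ x) :
    ∀ᵐ x : Space, x ∈ S → ψ x ≤ max KI KU * r * φ x := by
  filter_upwards [hI, hU] with x h1 h2
  intro hxS
  by_cases hxT : x ∈ T
  · have h : ψ x ≤ KI * (r * φ x) := by
      rw [← mul_assoc]
      exact (h1 hxT).2
    rw [mul_assoc]
    exact le_max_mul_left (hψ x) hKI h
  · have h : ψ x ≤ KU * (r * φ x) := by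
      rw [← mul_assoc]
      exact h2 hxS fun h' => hxT (hsub h')
    rw [mul_assoc]
    exact le_max_mul_right (hψ x) hKU h

/-- Lower comparison on the whole inner cube `S` from the interior two-sided bound on `T` and the
boundary lower bound on `S ∖ T'`, `T' ⊆ T`. [folklore] -/
theorem ae_lower_of_interior_of_layer {S T T' : Set Space} {ψ φ : Space → ℝ} {KI KL r : ℝ}
    (hsub : T' ⊆ T) (hψ : ∀ x, 0 ≤ ψ x)
    (hI : ∀ᵐ x : Space, x ∈ T → r * φ x ≤ KI * ψ x ∧ ψ x ≤ KI * r * φ x)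
    (hL : ∀ᵐ x : Space, x ∈ S → x ∉ T' → r * φ x ≤ KL * ψ x) :
    ∀ᵐ x : Space, x ∈ S → r * φ x ≤ max KI KL * ψ x := by
  filter_upwards [hI, hL] with x h1 h2
  intro hxS
  by_cases hxT : x ∈ T
  · exact (h1 hxT).1.trans (mul_le_mul_of_nonneg_right (le_max_left _ _) (hψ x))
  · exact (h2 hxS fun h' => hxT (hsub h')).trans
      (mul_le_mul_of_nonneg_right (le_max_right _ _) (hψ x))

/-- **One-sided bounds ⇒ no violating pairs.** If for a.e. `x ∈ S` the slice `ψ` is dominated by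
`K₁ r φ` and for a.e. `y ∈ S` the level `r φ` is dominated by `K₂ ψ`, and the profile `s` is `≡ 1` on
`S`, then the set of pairs `(x, y) ∈ S²` with `K₁K₂ ψ(y) φ(x) s(x) < ψ(x) φ(y) s(y)` is Lebesgue-null
(it lies in `(N_U × ℝ³) ∪ (ℝ³ × N_L)` with `N_U, N_L` null; `Measure.prod_prod`). [folklore] -/
theorem volume_violating_eq_zero {S : Set Space} {ψ φ s : Space → ℝ} {K₁ K₂ r : ℝ}
    (hK₁ : 0 ≤ K₁) (hφ : ∀ x, 0 ≤ φ x) (hs : ∀ z ∈ S, s z = 1)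
    (hU : ∀ᵐ x : Space, x ∈ S → ψ x ≤ K₁ * r * φ x)
    (hL : ∀ᵐ y : Space, y ∈ S → r * φ y ≤ K₂ * ψ y) :
    volume {p : Space × Space | p.1 ∈ S ∧ p.2 ∈ S ∧
      K₁ * K₂ * (ψ p.2 * φ p.1 * s p.1) < ψ p.1 * φ p.2 * s p.2} = 0 := by
  have hU' := ae_iff.1 hU
  have hL' := ae_iff.1 hL
  refine measure_mono_null (fun p hp => ?_)
    (measure_union_null (s := {x : Space | ¬(x ∈ S → ψ x ≤ K₁ * r * φ x)} ×ˢ (Set.univ : Set Space))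
      (t := (Set.univ : Set Space) ×ˢ {y : Space | ¬(y ∈ S → r * φ y ≤ K₂ * ψ y)}) ?_ ?_)
  · obtain ⟨hx, hy, hlt⟩ := hp
    by_contra hmem
    simp only [Set.mem_union, Set.mem_prod, Set.mem_univ, Set.mem_setOf_eq, and_true, true_and,
      not_or, not_not] at hmem
    obtain ⟨h1, h2⟩ := hmem
    have e1 : ψ p.1 * φ p.2 ≤ K₁ * r * φ p.1 * φ p.2 := mul_le_mul_of_nonneg_right (h1 hx) (hφ p.2)
    have e2 : K₁ * φ p.1 * (r * φ p.2) ≤ K₁ * φ p.1 * (K₂ * ψ p.2) :=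
      mul_le_mul_of_nonneg_left (h2 hy) (mul_nonneg hK₁ (hφ p.1))
    have key : ψ p.1 * φ p.2 * s p.2 ≤ K₁ * K₂ * (ψ p.2 * φ p.1 * s p.1) := by
      calc ψ p.1 * φ p.2 * s p.2 = ψ p.1 * φ p.2 := by rw [hs p.2 hy, mul_one]
        _ ≤ K₁ * r * φ p.1 * φ p.2 := e1
        _ = K₁ * φ p.1 * (r * φ p.2) := by ring
        _ ≤ K₁ * φ p.1 * (K₂ * ψ p.2) := e2
        _ = K₁ * K₂ * (ψ p.2 * φ p.1 * s p.1) := by rw [hs p.1 hx]; ring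
    exact absurd key (not_le.2 hlt)
  · rw [Measure.volume_eq_prod, Measure.prod_prod, hU', zero_mul]
  · rw [Measure.volume_eq_prod, Measure.prod_prod, hL', mul_zero]

/-- Indicator bookkeeping: if every `Y ∉ B` is also `∉ Bad`, then `1_{Bad}·m ≤ 1_B m` pointwise. [folklore] -/
theorem indicator_one_mul_le {α : Type*} {Bad B : Set α} {Y : α} (h : Y ∉ B → Y ∉ Bad)
    (m : α → ℝ≥0∞) : Bad.indicator (fun _ => (1 : ℝ≥0∞)) Y * m Y ≤ B.indicator m Y := by
  by_cases hY : Y ∈ B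
  · rw [Set.indicator_of_mem hY]
    have h1 : Bad.indicator (fun _ => (1 : ℝ≥0∞)) Y ≤ 1 :=
      Set.indicator_apply_le' (fun _ => le_rfl) (fun _ => zero_le_one)
    calc Bad.indicator (fun _ => (1 : ℝ≥0∞)) Y * m Y ≤ 1 * m Y := mul_le_mul_of_nonneg_right h1 (by simp)
      _ = m Y := one_mul _
  · rw [Set.indicator_of_notMem hY, Set.indicator_of_notMem (h hY), zero_mul]

/-! ## Composition (sorry-free) -/

/-- **Interior Harnack + boundary Carleson + boundary healing ⇒ WallDressing.** Merge the margins
(`a₀ = max`), densities (`ρ₀ = min`), call the interior stub at `ε* = min ε₂ ε₃` and every stub with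
budget `η/3`; take `C = max K₁ K₂ · max K₁ K₃` and the scale `ℓ = min a (εL)`, for which the wall
profile is `≡ 1` on `Λ_a`; assemble the upper bound on `Λ_a` from interior-upper on `Λ_{ε*}` and
Carleson on `Λ_a ∖ Λ_{ε₂}`, the lower bound likewise; a good environment then has a Lebesgue-null
violating-pair set (`volume_violating_eq_zero`), so the bad environments sit inside `B₁ ∪ B₂ ∪ B₃`,
whose `w_D`-mass is `≤ η` by `lintegral_indicator_le` and `lintegral_union_le`. [folklore] -/
theorem wallDressing_of_harnack (h₁ : InteriorHarnack) (h₂ : BoundaryCarleson)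
    (h₃ : BoundaryHealing) : WallDressing := by
  intro v hv
  obtain ⟨a₁, ha₁, H1⟩ := h₁ v hv
  obtain ⟨a₂, ha₂, H2⟩ := h₂ v hv
  obtain ⟨a₃, ha₃, H3⟩ := h₃ v hv
  refine ⟨max a₁ (max a₂ a₃), ha₁.trans_le (le_max_left _ _), fun a ha => ?_⟩
  have ha1 : a₁ ≤ a := (le_max_left _ _).trans ha
  have ha2 : a₂ ≤ a := ((le_max_left _ _).trans (le_max_right _ _)).trans ha
  have ha3 : a₃ ≤ a := ((le_max_right _ _).trans (le_max_right _ _)).trans ha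
  have ha0 : 0 < a := ha₁.trans_le ha1
  obtain ⟨ρ₁, hρ₁, H1⟩ := H1 a ha1
  obtain ⟨ρ₂, hρ₂, H2⟩ := H2 a ha2
  obtain ⟨ρ₃, hρ₃, H3⟩ := H3 a ha3
  refine ⟨min ρ₁ (min ρ₂ ρ₃), lt_min hρ₁ (lt_min hρ₂ hρ₃), fun ρ hρ hρlt ε hε η hη => ?_⟩
  have hρ1 : ρ < ρ₁ := hρlt.trans_le (min_le_left _ _)
  have hρ2 : ρ < ρ₂ := hρlt.trans_le ((min_le_right _ _).trans (min_le_left _ _))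
  have hρ3 : ρ < ρ₃ := hρlt.trans_le ((min_le_right _ _).trans (min_le_right _ _))
  obtain ⟨ε₂, hε₂, H2⟩ := H2 ρ hρ hρ2
  obtain ⟨ε₃, hε₃, H3⟩ := H3 ρ hρ hρ3
  have hη3 : 0 < η / 3 := by positivity
  obtain ⟨K₁, hK₁, E1⟩ := H1 ρ hρ hρ1 (min ε₂ ε₃) (lt_min hε₂ hε₃) (η / 3) hη3
  obtain ⟨K₂, hK₂, E2⟩ := H2 (η / 3) hη3
  obtain ⟨K₃, hK₃, E3⟩ := H3 (η / 3) hη3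
  refine ⟨max K₁ K₂ * max K₁ K₃,
    mul_pos (hK₁.trans_le (le_max_left _ _)) (hK₁.trans_le (le_max_left _ _)), ?_⟩
  filter_upwards [E1, E2, E3] with N hN1 hN2 hN3
  have hLpos : 0 < sideLength ρ (N + 1) := sideLength_succ_pos hρ N
  have hℓpos : 0 < min a (ε * sideLength ρ (N + 1)) := lt_min ha0 (mul_pos hε hLpos)
  dsimp only at hN1 hN2 hN3 ⊢
  intro hUniq
  refine ⟨min a (ε * sideLength ρ (N + 1)), hℓpos, min_le_right _ _, fun Φ₀ hΦ₀ => ?_⟩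
  obtain ⟨B₁, hB₁, G1⟩ := hN1 hUniq Φ₀ hΦ₀
  obtain ⟨B₂, hB₂, G2⟩ := hN2 hUniq Φ₀ hΦ₀
  obtain ⟨B₃, hB₃, G3⟩ := hN3 hUniq Φ₀ hΦ₀
  have hΦnn : ∀ X, 0 ≤ Φ₀ X := hΦ₀.2.2.1
  refine (lintegral_mono fun Y => ?_).trans
    ((lintegral_indicator_le _ (B₁ ∪ B₂ ∪ B₃)).trans
      ((lintegral_union_le _ (B₁ ∪ B₂) B₃).trans
        ((add_le_add ((lintegral_union_le _ B₁ B₂).trans (add_le_add hB₁ hB₂)) hB₃).trans_eq ?_)))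
  · refine indicator_one_mul_le (fun hY hbad => ?_) _
    simp only [Set.mem_union, not_or] at hY
    obtain ⟨⟨hY1, hY2⟩, hY3⟩ := hY
    exact hbad <| volume_violating_eq_zero
      (ψ := fun x => groundState v (N + 1) (sideLength ρ (N + 1)) (Matrix.vecCons x Y))
      (φ := fun x => Φ₀ (Matrix.vecCons x Y))
      (s := fun z => ∏ k : Fin 3, min 1 (min (z k / min a (ε * sideLength ρ (N + 1)))
        ((sideLength ρ (N + 1) - z k) / min a (ε * sideLength ρ (N + 1)))))
      (hK₁.le.trans (le_max_left _ _)) (fun x => hΦnn _)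
      (fun z hz => wallProfile_eq_one hℓpos (min_le_left _ _) hz)
      (ae_upper_of_interior_of_layer (innerCube_mono hLpos.le (min_le_left ε₂ ε₃))
        (fun x => groundState_nonneg _ _ _ _) hK₁ hK₂ (G1 Y hY1) (G2 Y hY2))
      (ae_lower_of_interior_of_layer (innerCube_mono hLpos.le (min_le_right ε₂ ε₃))
        (fun x => groundState_nonneg _ _ _ _) (G1 Y hY1) (G3 Y hY3))
  · rw [← ENNReal.ofReal_add hη3.le hη3.le, ← ENNReal.ofReal_add (by positivity) hη3.le, add_thirds]

/-- **The crux from the three stubs, BY NAME** (no `sorry` of its own, none inherited: the stubs enter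
as hypotheses under their registered names; axioms propext / Classical.choice / Quot.sound). [folklore] -/
theorem WallDressing_of (h₁ : __Registered.stub_interiorHarnack)
    (h₂ : __Registered.stub_boundaryCarleson) (h₃ : __Registered.stub_boundaryHealing) :
    WallDressing :=
  wallDressing_of_harnack h₁ h₂ h₃

/-- Wiring check (an `example`, so that `WallDressing_of` stays the only theorem concluding the crux): the
stubs, with their written-out tree-vocabulary types, feed the skeleton theorem as stated — this term becomes
the crux proof when the three `sorry`s above are discharged. -/
example : WallDressing :=
  WallDressing_of stub_interiorHarnack stub_boundaryCarleson stub_boundaryHealing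

end Summit.AtomisticToContinuum.BoseEinsteinCondensation.Cruxes.WallDressing.Birth

end
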